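import Literature.Barriers.AtomisticToContinuum.NoBVEstimatesMultiDCoeffFields
import Literature.Barriers.AtomisticToContinuum.NoBVEstimatesMultiDRegField
import HarnessLib

/-!
# The normalised cut-off coefficients of a symmetrizable system are tame

Brick B-γ, §4, of the Kato existence programme for the symmetrizable branch of Rauch's Local
Existence Theorem (towards `Rauch1986_smallAmplitudeExpansionL2`): the operator fields
`aⱼ(y) = Ãⱼ(ū + y)`, `b(y) = B̃(ū + y)` of the normalised cut-off system
(`NoBVEstimatesMultiDCoeffFields.lean`), recentred at the constant state, satisfy `IsTameCoeff`
(`NoBVEstimatesMultiDRegField.lean`): they are smooth and constant off a ball, hence bounded with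
bounded derivatives (`exists_bound_iteratedFDeriv_of_eventually_const`), and `b(0) = 0` because
`B(ū) = 0`. Consequently (`exists_regularised_flow`) **the regularised normalised system has a
global forward flow on `L²` for every `δ > 0`** (`exists_regularised_flow_normalize`).

Everything is proved; no named fact and no `sorry` is introduced.

## References

* [Majda1984] A. Majda, *Compressible Fluid Flow and Systems of Conservation Laws in Several
  Space Variables* (1984), Ch. 2, §2.1.
-/

noncomputable section

open MeasureTheory Set Function Filter Metric WithLp Matrix
open scoped ContDiff Topology

namespace Literature.Barriers.AtomisticToContinuum

open Literature.Analysis.FluidPDE Literature.Analysis.PDE Literature.Analysis.FunctionSpaces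
  QuasilinearSystem

variable {d k : ℕ}

/-! ### Euclidean versus sup norm on `ℝᵏ` -/

/-- `‖y‖₂ ≤ (k + 1) ‖y‖_∞` on `ℝᵏ`. [folklore] -/
theorem norm_le_succ_mul_norm_ofLp (y : EuclideanSpace ℝ (Fin k)) : ‖y‖ ≤ (k + 1) * ‖ofLp y‖ := by
  have hsq : ‖y‖ ^ 2 ≤ ((k + 1) * ‖ofLp y‖) ^ 2 := by
    rw [EuclideanSpace.norm_eq, Real.sq_sqrt (Finset.sum_nonneg fun _ _ => sq_nonneg _)]
    calc ∑ i, ‖(ofLp y) i‖ ^ 2 ≤ ∑ _i : Fin k, ‖ofLp y‖ ^ 2 :=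
          Finset.sum_le_sum fun i _ => pow_le_pow_left₀ (norm_nonneg _) (norm_le_pi_norm _ i) 2
      _ = k * ‖ofLp y‖ ^ 2 := by simp
      _ ≤ ((k + 1) * ‖ofLp y‖) ^ 2 := by nlinarith [sq_nonneg ‖ofLp y‖, norm_nonneg (ofLp y)]
  exact (pow_le_pow_iff_left₀ (norm_nonneg _) (by positivity) two_ne_zero).1 hsq

/-- Far from `0` in the Euclidean norm is far from `ū` in the sup norm after recentring:
`2r(k+1) ≤ ‖y‖₂ ⟹ 2r ≤ dist (ū + y) ū`. [folklore] -/
theorem le_dist_of_le_norm {ubar : Fin k → ℝ} {r : ℝ} {y : EuclideanSpace ℝ (Fin k)}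
    (hy : 2 * r * (k + 1) ≤ dist y 0) : 2 * r ≤ dist (ofLp (toLp 2 ubar + y)) ubar := by
  rw [dist_zero_right] at hy
  rw [dist_eq_norm, WithLp.ofLp_add, WithLp.ofLp_toLp, add_sub_cancel_left]
  have h := norm_le_succ_mul_norm_ofLp y
  have hk : (0 : ℝ) < k + 1 := by positivity
  refine le_of_mul_le_mul_right ?_ hk
  rw [mul_comm ‖ofLp y‖]
  exact hy.trans h

/-! ### The recentred coefficients and their tameness -/

section Tame

variable (S : QuasilinearSystem d k) (Sym : (Fin k → ℝ) → Matrix (Fin k) (Fin k) ℝ)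
  (ubar : Fin k → ℝ) {r : ℝ} (hr : 0 < r)
  (hSym : ∀ w ∈ closedBall ubar (2 * r), (Sym w * S.A0 w).PosDef ∧ ∀ j, (Sym w * S.A j w).IsSymm)

/-- **`aⱼ(y) = Ãⱼ(ū + y)`**, the transport coefficients recentred at the constant state.
[cite: Majda1984, Ch. 2 §2.1] -/
def aCoef (j : Fin d) (y : EuclideanSpace ℝ (Fin k)) :
    EuclideanSpace ℝ (Fin k) →L[ℝ] EuclideanSpace ℝ (Fin k) :=
  Aop S Sym ubar hr hSym j (toLp 2 ubar + y)

/-- **`b(y) = B̃(ū + y)`**, the zeroth-order term recentred at the constant state.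
[cite: Majda1984, Ch. 2 §2.1] -/
def bCoef (y : EuclideanSpace ℝ (Fin k)) : EuclideanSpace ℝ (Fin k) :=
  Bvec S Sym ubar hr hSym (toLp 2 ubar + y)

/-- **`s(y) = S̃(ū + y)`**, the symmetrizer recentred at the constant state.
[cite: Majda1984, Ch. 2 §2.1] -/
def sCoef (y : EuclideanSpace ℝ (Fin k)) : EuclideanSpace ℝ (Fin k) →L[ℝ] EuclideanSpace ℝ (Fin k) :=
  Sop S Sym ubar hr (toLp 2 ubar + y)

/-- `aⱼ` is smooth. [folklore] -/
theorem contDiff_aCoef (j : Fin d) : ContDiff ℝ ∞ (aCoef S Sym ubar hr hSym j) :=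
  (contDiff_Aop S Sym ubar hr hSym j).comp (contDiff_const.add contDiff_id)

/-- `b` is smooth. [folklore] -/
theorem contDiff_bCoef : ContDiff ℝ ∞ (bCoef S Sym ubar hr hSym) :=
  (contDiff_Bvec S Sym ubar hr hSym).comp (contDiff_const.add contDiff_id)

/-- `s` is smooth. [folklore] -/
theorem contDiff_sCoef (hSymd : ∀ i i', ContDiff ℝ ∞ fun u => Sym u i i') :
    ContDiff ℝ ∞ (sCoef S Sym ubar hr) :=
  (contDiff_Sop S Sym ubar hr hSymd).comp (contDiff_const.add contDiff_id)

/-- `aⱼ` is constant off the Euclidean ball of radius `2r(k+1)`. [folklore] -/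
theorem aCoef_of_le_dist (j : Fin d) (y : EuclideanSpace ℝ (Fin k)) (hy : 2 * r * (k + 1) ≤ dist y 0) :
    aCoef S Sym ubar hr hSym j y = opCLM ((S.A0 ubar)⁻¹ * S.A j ubar) :=
  Aop_of_le_dist S Sym ubar hr hSym j (le_dist_of_le_norm hy)

/-- `b` is constant off the Euclidean ball of radius `2r(k+1)`. [folklore] -/
theorem bCoef_of_le_dist (y : EuclideanSpace ℝ (Fin k)) (hy : 2 * r * (k + 1) ≤ dist y 0) :
    bCoef S Sym ubar hr hSym y = toLp 2 ((S.A0 ubar)⁻¹ *ᵥ S.B ubar) :=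
  Bvec_of_le_dist S Sym ubar hr hSym (le_dist_of_le_norm hy)

/-- `s` is constant off the Euclidean ball of radius `2r(k+1)`. [folklore] -/
theorem sCoef_of_le_dist (y : EuclideanSpace ℝ (Fin k)) (hy : 2 * r * (k + 1) ≤ dist y 0) :
    sCoef S Sym ubar hr y = opCLM (Sym ubar * S.A0 ubar) :=
  Sop_of_le_dist S Sym ubar hr (le_dist_of_le_norm hy)

/-- `b(0) = 0` when `B(ū) = 0`. [folklore] -/
theorem bCoef_zero (hB : S.B ubar = 0) : bCoef S Sym ubar hr hSym 0 = 0 := by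
  rw [bCoef, add_zero]
  exact Bvec_ubar S Sym ubar hr hSym hB

/-- **Uniform bounds for a smooth field constant off a ball, orders `0` and `1`.** [folklore] -/
theorem exists_bound_zero_one {V : Type*} [NormedAddCommGroup V] [NormedSpace ℝ V]
    {f : EuclideanSpace ℝ (Fin k) → V} (hf : ContDiff ℝ ∞ f) {c₀ : V} {R : ℝ}
    (hR : ∀ y, R ≤ dist y 0 → f y = c₀) :
    ∃ C : ℝ, 0 ≤ C ∧ (∀ y, ‖f y‖ ≤ C) ∧ ∀ y, ‖fderiv ℝ f y‖ ≤ C := by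
  obtain ⟨C₀, hC₀, h0⟩ := exists_bound_iteratedFDeriv_of_eventually_const hf (c := 0) hR 0
  obtain ⟨C₁, hC₁, h1⟩ := exists_bound_iteratedFDeriv_of_eventually_const hf (c := 0) hR 1
  refine ⟨max C₀ C₁, le_max_of_le_left hC₀, fun y => ?_, fun y => ?_⟩
  · have h := h0 y
    rw [norm_iteratedFDeriv_zero] at h
    exact h.trans (le_max_left _ _)
  · have h := h1 y
    rw [norm_iteratedFDeriv_one] at h
    exact h.trans (le_max_right _ _)

/-- **The recentred normalised cut-off coefficients are tame** (`IsTameCoeff M L a b` for some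
`M, L`). [cite: Majda1984, Ch. 2 §2.1] -/
theorem exists_isTameCoeff (hB : S.B ubar = 0) :
    ∃ M L : ℝ, IsTameCoeff M L (aCoef S Sym ubar hr hSym) (bCoef S Sym ubar hr hSym) := by
  -- bounds for each `aⱼ` and for `b`
  have ha : ∀ j, ∃ C : ℝ, 0 ≤ C ∧ (∀ y, ‖aCoef S Sym ubar hr hSym j y‖ ≤ C) ∧
      ∀ y, ‖fderiv ℝ (aCoef S Sym ubar hr hSym j) y‖ ≤ C := fun j =>
    exists_bound_zero_one (contDiff_aCoef S Sym ubar hr hSym j) (aCoef_of_le_dist S Sym ubar hr hSym j)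
  obtain ⟨Cb, hCb, -, hb1⟩ :=
    exists_bound_zero_one (contDiff_bCoef S Sym ubar hr hSym) (bCoef_of_le_dist S Sym ubar hr hSym)
  choose C hC hC0 hC1 using ha
  refine ⟨∑ j, C j, Cb, ?_⟩
  have hle : ∀ j, C j ≤ ∑ i, C i := fun j =>
    Finset.single_le_sum (f := C) (fun i _ => hC i) (Finset.mem_univ j)
  exact
    { contDiff_a := fun j => (contDiff_aCoef S Sym ubar hr hSym j).of_le (by exact_mod_cast le_top)
      contDiff_b := (contDiff_bCoef S Sym ubar hr hSym).of_le (by exact_mod_cast le_top)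
      norm_a := fun j y => (hC0 j y).trans (hle j)
      norm_fderiv_a := fun j y => (hC1 j y).trans (hle j)
      b_zero := bCoef_zero S Sym ubar hr hSym hB
      norm_fderiv_b := hb1
      M_nonneg := Finset.sum_nonneg fun i _ => hC i
      L_nonneg := hCb }

/-- **Global forward flow of the regularised normalised system**: for a quasilinear system
symmetrizable on `B̄(ū, 2r)` with `B(ū) = 0`, every `δ > 0` and every `U₀ ∈ L²(ℝᵈ; ℝᵏ)`, the
regularised equation `U' = F_δ(U)` built on the recentred normalised cut-off coefficients has a
solution on `[0, ∞)` with `U(0) = U₀`. [cite: Majda1984, Ch. 2 §2.1] -/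
theorem exists_regularised_flow_normalize (hB : S.B ubar = 0) {δ : ℝ} (hδ : 0 < δ)
    (U₀ : Lp (EuclideanSpace ℝ (Fin k)) 2 (volume : Measure (EuclideanSpace ℝ (Fin d)))) :
    ∃ (M L : ℝ) (h : IsTameCoeff M L (aCoef S Sym ubar hr hSym) (bCoef S Sym ubar hr hSym))
      (U : ℝ → Lp (EuclideanSpace ℝ (Fin k)) 2 (volume : Measure (EuclideanSpace ℝ (Fin d)))),
      U 0 = U₀ ∧ ∀ T, ∀ t ∈ Icc 0 T, HasDerivWithinAt U (regField h hδ (U t)) (Icc 0 T) t := by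
  obtain ⟨M, L, h⟩ := exists_isTameCoeff S Sym ubar hr hSym hB
  obtain ⟨U, hU0, hU⟩ := exists_regularised_flow h hδ U₀
  exact ⟨M, L, h, U, hU0, hU⟩

end Tame

end Literature.Barriers.AtomisticToContinuum

end
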